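import Literature.Probability.RandomPlanarGeometry.HexSAWStripEpsWalks
import Literature.Probability.RandomPlanarGeometry.HexSAWStripSurfaceThresholdClasses
import HarnessLib

/-!
# The arch series `A_T(x_c; y)` diverges beyond `y_T`: the second half of the common-radius clause of BBdGDCG14 Corollary 8,
# by turning side exits into arches

Topic `Literature/Probability/RandomPlanarGeometry` (continues `HexSAWStripSurfaceThresholdClasses.lean` — which proves ONE half of
the printed common-radius clause at `x = x_c`: on the whole boundedness set `HV.stripBddSet T` of the bridge class
`L ↦ B_{T,L}(x_c; y)` the arch class `L ↦ A_{T,L}(x_c; y)` is bounded (`HV.stripBddSet_subset_alpha`,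
`HV.bddAbove_stripGFy_alpha_of_beta`), and records "lane: one half" —, `HexSAWStripEpsWalks.lean` (`HV.epsWalks`, `HV.eps_anatomy`,
`HV.eps_exit_unique`) and the capstone `HexSAWSurfaceFugacity.lean` (`HV.stripBddSet`, `HV.stripYT`, `HV.le_stripYT`,
`HV.stripGFy_mono`).  Source: N. R. Beaton, M. Bousquet-Mélou, J. de Gier,
H. Duminil-Copin, A. J. Guttmann, *The critical fugacity for surface adsorption of self-avoiding walks on the honeycomb lattice is
`1 + √2`*, Comm. Math. Phys. 326 (2014) 727–754, arXiv:1109.0358v5, §3.2, Corollary 8 (p. 12): "The series (in `y`) `A_T(x_c, y)`,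
`B_T(x_c, y)` and `C_T(x_c, y)` have radius of convergence `y_T`"; proof (p. 13): "The argument is the same for the three series"
(printed mechanism: the three series are rational with the common radius `ρ_T(y)` in `x`, Propositions 6–7).  The identity used
below is (16) (§4.1, p. 13) = `HV.stripIdentityY_holds`: `cos(3π/8) A_{T,L}(x_c;y) + cos(π/4) E_{T,L}(x_c;y) + β(y) B_{T,L}(x_c;y) = 1`.

## What is proved (namespace `Literature.Probability.RandomPlanarGeometry.SAW.HV`; `T ≥ 1`; standard axioms)

* The surgery `epsToArch`: a walk of `S_{T,L}` from `a` to a side exit `ε ∪ ε̄` (it leaves through one of the two oblique cuts, at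
  height `m ≤ T − 1`) is continued, inside `S_{T,L+1}` and outside `S_{T,L}`, down the boundary column just beyond the cut to the
  bottom line, where it leaves through an `α` mid-edge: an ARCH of `S_{T,L+1}` with the same surface contacts and `2m + 1 ≤ 2T − 1`
  more vertices (`exitTail`, `exitEnd`, `epsToArch_mem`, `surfContacts_epsToArch`, `mwLen_epsToArch`, `epsToArch_injOn`);
* **`mul_stripGFy_eps_le_alpha_succ`** — `x_c^{2T−1} · E_{T,L}(x_c; y) ≤ A_{T,L+1}(x_c; y)` for every `y ≥ 0`;
* **`stripGFy_beta_le_of_alpha_le`**, **`bddAbove_stripGFy_beta_of_alpha`** — for `y > y* = 1 + √2` (where `β(y) < 0`), bounded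
  arches force bounded bridges: `|β(y)| B_{T,L} ≤ (cos(3π/8) + cos(π/4) x_c^{1−2T}) · sup_L A_{T,L}`;
* **`mem_stripBddSet_of_bddAbove_alpha`** (`0 ≤ y`, `y ≠ y*`) with the tree's converse `stripBddSet_subset_alpha`: away from the
  single point `y*` the arch class and the bridge class are bounded at the same fugacities;
* ★ **`not_bddAbove_stripGFy_alpha_of_stripYT_lt`** — for `y > y_T` the arch class `L ↦ A_{T,L}(x_c; y)` is UNBOUNDED, i.e. the
  radius of `A_T(x_c; ·)` is at most `y_T`: with `HexSAWStripSurfaceThresholdClasses.lean` (at least `y_T`) the arch series has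
  radius EXACTLY `y_T`, the printed common-radius clause for `A_T`; `tendsto_stripGFy_alpha_atTop_of_stripYT_lt` — `A_{T,L} → ∞`.

(The point `y = y*` itself is not exceptional — `y* < y_T`, so both classes are bounded there — but that strict inequality is the
lane's «THRESHOLD-RATE» file; here only tree facts are used, hence the hypothesis `y ≠ y*` in the equivalence.)

Label: CONSOLIDATION BY A DIFFERENT PROOF of a printed clause (Corollary 8, radius of `A_T(x_c; ·)` `≤ y_T`), by an injective
weight-controlled surgery `ε`-walks → arches and the identity (16), instead of rationality.  Lane «pcv-sawmu», a-p2 g11, 2026-08-23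
(ed.2: two page tokens of lit-1 g16, docstring-only).

Editions and consumers (lane «pcv-sawmu»).  ed.1 44c808d98d89f8ee (HOME, a-p2 g11); ed.2 6afdeaeefd5e4b6f = ed.1 + lit-1 g16's page tokens AR1–AR2
(docstring-only), landed as p373186 (2026-08-23); ed.3 (a-p2 g14, 2026-08-24) = ed.2 + this paragraph (no code change).  Consumers: the
lane's «THRESHOLD+» car `HexSAWStripSurfaceThresholdRate.lean` (uses `mem_stripBddSet_iff_bddAbove_alpha`,
`not_bddAbove_stripGFy_alpha_of_stripYT_lt`, `not_bddAbove_stripGFy_beta_of_stripYT_lt`, `stripGFy_eps_le_mul_alpha_succ` and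
`betaY_neg_of_yStar_lt` for the strict inequality `y* < y_T`, the identification `ν_T(y_T) = x_c⁻¹` and the arch-coefficient divergence at `y_T`).
-/

noncomputable section

open Finset Filter Topology

namespace Literature.Probability.RandomPlanarGeometry.SAW.HV

/-! ### The boundary column beyond an oblique cut -/

/-- Abscissa of the vertex of type `b` on row `j` of the boundary column of `S_{T,L+1} ∖ S_{T,L}` beyond the right cut (`r = true`:
`x₀ = L + 1`) or beyond the left cut (`r = false`: `x₀ = −(L+1) − j − b`). [cite: DuminilCopinSmirnov2012, §3 (S_{T,L}: the cuts at distance L, Fig. 3)] -/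
def exitX (r : Bool) (L : ℕ) (j : ℤ) (b : Bool) : ℤ :=
  if r then (L : ℤ) + 1 else -(L : ℤ) - 1 - j - (if b then 1 else 0)

/-- The boundary column below row `m`, listed downwards: rows `m − 1, …, 0`, on each row the vertex of type `1` (odd level) then
the vertex of type `0` (even level). [cite: DuminilCopinSmirnov2012, §3 (Fig. 3)] -/
def exitCol (r : Bool) (L : ℕ) : ℕ → List HV
  | 0 => []
  | j + 1 => (exitX r L j true, (j : ℤ), true) :: (exitX r L j false, (j : ℤ), false) :: exitCol r L j

/-- The descending boundary column from the even vertex of row `m` (level `2m`) down to level `0`. [cite: DuminilCopinSmirnov2012, §3 (Fig. 3)] -/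
def exitTail (r : Bool) (L m : ℕ) : List HV := (exitX r L m false, (m : ℤ), false) :: exitCol r L m

/-- The outer endpoint of the `α` mid-edge below the boundary column (level `−1`). [cite: DuminilCopinSmirnov2012, §3 (α)] -/
def exitEnd (r : Bool) (L : ℕ) : HV := (exitX r L 0 false, -1, true)

/-- Unfolding one row of the column. [cite: DuminilCopinSmirnov2012, §3] -/
theorem exitTail_succ (r : Bool) (L m : ℕ) :
    exitTail r L (m + 1) = (exitX r L (m + 1) false, ((m + 1 : ℕ) : ℤ), false) :: (exitX r L m true, (m : ℤ), true) :: exitTail r L m :=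
  rfl

/-- The column has `2m + 1` vertices. [cite: DuminilCopinSmirnov2012, §3] -/
theorem length_exitTail (r : Bool) (L m : ℕ) : (exitTail r L m).length = 2 * m + 1 := by
  induction m with
  | zero => rfl
  | succ m ih => rw [exitTail_succ, List.length_cons, List.length_cons, ih]; ring

/-- The column is never empty. [cite: DuminilCopinSmirnov2012, §3] -/
theorem exitTail_ne_nil (r : Bool) (L m : ℕ) : exitTail r L m ≠ [] := List.cons_ne_nil _ _

/-- Coordinates along the column: rows in `[0, m]`, levels `≤ 2m`, abscissa on the boundary line of `S_{T,L+1}`.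
[cite: DuminilCopinSmirnov2012, §3 (Fig. 3)] -/
theorem mem_exitTail {r : Bool} {L m : ℕ} {v : HV} (hv : v ∈ exitTail r L m) :
    0 ≤ v.2.1 ∧ v.2.1 ≤ m ∧ lev v ≤ 2 * (m : ℤ) ∧ v.1 = exitX r L v.2.1 v.2.2 := by
  induction m with
  | zero =>
    simp only [exitTail, exitCol, List.mem_singleton] at hv
    subst hv; simp
  | succ m ih =>
    rw [exitTail_succ] at hv
    rcases List.mem_cons.1 hv with rfl | hv
    · refine ⟨by positivity, by push_cast; omega, ?_, rfl⟩
      simp only [lev_mk, bit_false]; push_cast; omega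
    rcases List.mem_cons.1 hv with rfl | hv
    · refine ⟨by positivity, by push_cast; omega, ?_, rfl⟩
      simp only [lev_mk, bit_true]; push_cast; omega
    · obtain ⟨h1, h2, h3, h4⟩ := ih hv
      exact ⟨h1, by push_cast; omega, by push_cast; omega, h4⟩

/-- The last vertex of the column is the even vertex of row `0`. [cite: DuminilCopinSmirnov2012, §3] -/
theorem getLast_exitTail (r : Bool) (L m : ℕ) :
    (exitTail r L m).getLast (exitTail_ne_nil r L m) = (exitX r L 0 false, 0, false) := by
  induction m with
  | zero => rfl
  | succ m ih =>
    rw [← Option.some_inj, ← List.getLast?_eq_some_getLast, exitTail_succ, List.getLast?_cons_cons,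
      List.getLast?_cons_of_ne_nil (exitTail_ne_nil r L m), List.getLast?_eq_some_getLast (exitTail_ne_nil r L m), ih]

/-- The head of the column is the even vertex of row `m`. [cite: DuminilCopinSmirnov2012, §3] -/
theorem head?_exitTail (r : Bool) (L m : ℕ) : (exitTail r L m).head? = some (exitX r L m false, (m : ℤ), false) := rfl

/-- The column is a path of `ℍ`. [cite: DuminilCopinSmirnov2012, §3 (every edge joins consecutive levels)] -/
theorem isChain_exitTail (r : Bool) (L m : ℕ) : (exitTail r L m).IsChain hvGraph.Adj := by
  induction m with
  | zero => exact List.isChain_singleton _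
  | succ m ih =>
    show List.IsChain hvGraph.Adj
      ((exitX r L (m + 1) false, ((m + 1 : ℕ) : ℤ), false) :: (exitX r L m true, (m : ℤ), true) ::
        ((exitX r L m false, (m : ℤ), false) :: exitCol r L m))
    refine List.IsChain.cons_cons ?_ (List.IsChain.cons_cons ?_ ih)
    · cases r
      · simp [hvGraph_adj, AdjRel, exitX]; omega
      · simp [hvGraph_adj, AdjRel, exitX]
    · cases r
      · simp [hvGraph_adj, AdjRel, exitX]
      · simp [hvGraph_adj, AdjRel, exitX]

/-- The column is self-avoiding (its levels strictly decrease). [cite: DuminilCopinSmirnov2012, §3] -/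
theorem nodup_exitTail (r : Bool) (L m : ℕ) : (exitTail r L m).Nodup := by
  induction m with
  | zero => exact List.nodup_singleton _
  | succ m ih =>
    rw [exitTail_succ, List.nodup_cons, List.nodup_cons]
    refine ⟨fun h => ?_, fun h => ?_, ih⟩
    · rcases List.mem_cons.1 h with h | h
      · simp at h
      · have := (mem_exitTail h).2.1; simp at this
    · have := (mem_exitTail h).2.2.1; simp only [lev_mk, bit_true] at this; omega

/-- The bottom vertex of the column is joined to the outer endpoint of the `α` mid-edge below it. [cite: DuminilCopinSmirnov2012, §3 (α)] -/
theorem adj_getLast_exitTail_exitEnd (r : Bool) (L m : ℕ) :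
    hvGraph.Adj ((exitTail r L m).getLast (exitTail_ne_nil r L m)) (exitEnd r L) := by
  rw [getLast_exitTail]
  simp [hvGraph_adj, AdjRel, exitEnd]

/-- The column lies outside `S_{T,L}`. [cite: DuminilCopinSmirnov2012, §3 (S_{T,L})] -/
theorem not_mem_stripV_of_mem_exitTail {r : Bool} {T L m : ℕ} {v : HV} (hv : v ∈ exitTail r L m) : v ∉ stripV T L := by
  obtain ⟨h1, -, -, h4⟩ := mem_exitTail hv
  obtain ⟨a, b, c⟩ := v
  simp only at h1 h4
  rw [mem_stripV_iff]
  subst h4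
  cases r <;> cases c <;> simp [exitX, bit]

/-- The column lies inside `S_{T,L+1}` as soon as its top row is `≤ T − 1`. [cite: DuminilCopinSmirnov2012, §3 (S_{T,L})] -/
theorem mem_stripV_succ_of_mem_exitTail {r : Bool} {T L m : ℕ} (hm : m + 1 ≤ T) {v : HV} (hv : v ∈ exitTail r L m) :
    v ∈ stripV T (L + 1) := by
  obtain ⟨h1, h2, h3, h4⟩ := mem_exitTail hv
  obtain ⟨a, b, c⟩ := v
  simp only at h1 h2 h4
  rw [mem_stripV_iff]
  subst h4
  simp only [lev_mk] at h3 ⊢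
  cases r <;> cases c <;> simp [exitX, bit] at h3 ⊢ <;> omega

/-! ### The surgery on an `ε`-walk -/

/-- Exit side of a walk of `S_{T,L}`: `true` iff its final half-edge crosses the right cut `x₀ = L`. [cite: DuminilCopinSmirnov2012, §3 (ε, ε̄)] -/
def exitSide (L : ℕ) (P : List HV) : Bool := decide ((finalDart P).1.1 = (L : ℤ))

/-- Exit row of a walk: the row `x₁` of its last visited vertex. [cite: DuminilCopinSmirnov2012, §3] -/
def exitRow (P : List HV) : ℕ := (finalDart P).1.2.1.toNat

/-- **The surgery**: continue an `ε`-walk of `S_{T,L}` down the boundary column beyond its cut and out through the `α` mid-edge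
below. [cite: BeatonBousquetMelouDeGierDuminilCopinGuttmann2014, Corollary 8 (arXiv v5 p. 12: the common radius of A_T and B_T); lane: the injection ε-walks → arches] -/
def epsToArch (L : ℕ) (P : List HV) : List HV :=
  wOut :: ((inner P ++ exitTail (exitSide L P) L (exitRow P)) ++ [exitEnd (exitSide L P) L])

variable {T L : ℕ}

/-- The exit vertex of an `ε`-dart from `z` is the head of the boundary column on the row of `z`. [cite: DuminilCopinSmirnov2012, §3 (ε, ε̄)] -/
theorem eps_exit_eq {z u : HV} (hz : 0 ≤ z.2.1) (h : IsEpsDart L (z, u)) :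
    u = (exitX (decide (z.1 = (L : ℤ))) L z.2.1.toNat false, ((z.2.1.toNat : ℕ) : ℤ), false) := by
  obtain ⟨a, b, c⟩ := z
  obtain ⟨hc, hx⟩ := h
  simp only at hc hx hz ⊢
  rcases hx with ⟨h1, rfl⟩ | ⟨h1, rfl⟩
  · have hne : ¬ (a = (L : ℤ)) := by omega
    simp [hne, exitX, Int.toNat_of_nonneg hz]; omega
  · simp [h1, exitX, Int.toNat_of_nonneg hz]

/-- Anatomy of the surgery on an `ε`-walk `w :: (l ++ [u])`: the result is `w :: ((l ++ column) ++ [end])`, the column starting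
at `u`. [cite: BeatonBousquetMelouDeGierDuminilCopinGuttmann2014, Corollary 8 (arXiv v5 p. 12); lane] -/
theorem epsToArch_spec (hT : 1 ≤ T) {P : List HV} (hP : P ∈ epsWalks T L) :
    ∃ (l : List HV) (hl : l ≠ []) (r : Bool) (m : ℕ), P = wOut :: (l ++ [(exitX r L m false, (m : ℤ), false)]) ∧
      epsToArch L P = wOut :: ((l ++ exitTail r L m) ++ [exitEnd r L]) ∧ l.IsChain hvGraph.Adj ∧ l.head? = some hvOrigin ∧
      l.Nodup ∧ (∀ x ∈ l, x ∈ stripV T L) ∧ m + 1 ≤ T ∧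
      hvGraph.Adj (l.getLast hl) (exitX r L m false, (m : ℤ), false) := by
  have hT' := hT
  obtain ⟨l, u, hl, rfl, hc, hh, hnd, hV, hε, -⟩ := eps_anatomy hP
  have hz := hV _ (List.getLast_mem hl)
  have hz0 : 0 ≤ (l.getLast hl).2.1 := (mem_stripV_iff.1 hz).1
  have hu := eps_exit_eq hz0 hε
  set r := decide ((l.getLast hl).1 = (L : ℤ))
  set m := (l.getLast hl).2.1.toNat
  have hadj : hvGraph.Adj (l.getLast hl) u :=
    ((isMidWalk_cons_append_iff _ hl u).1 (mem_midWalks_iff.1 (mem_filter.1 hP).1)).2.2.1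
  refine ⟨l, hl, r, m, by rw [hu], ?_, hc, hh, hnd, hV, ?_, by rw [← hu]; exact hadj⟩
  · have hside : exitSide L (wOut :: (l ++ [u])) = r := by rw [exitSide, finalDart_cons_append hl]
    have hrow : exitRow (wOut :: (l ++ [u])) = m := by rw [exitRow, finalDart_cons_append hl]
    rw [epsToArch, inner_cons_append, hside, hrow]
  · -- the last visited vertex is of type `1` on row `m`, inside `S_{T,L}`: level `2m + 1 ≤ 2T − 1`
    have hlev := (mem_stripV_iff.1 hz).2.1
    have hbit : bit (l.getLast hl) = 1 := by
      obtain ⟨hc1, -⟩ := hε; unfold bit; simp only at hc1; simp [hc1]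
    have hm : ((m : ℕ) : ℤ) = (l.getLast hl).2.1 := Int.toNat_of_nonneg hz0
    unfold lev at hlev
    omega

/-- **The surgery lands in the arches of `S_{T,L+1}`.** [cite: BeatonBousquetMelouDeGierDuminilCopinGuttmann2014, Corollary 8 (arXiv v5 p. 12); lane: the injection ε-walks → arches] -/
theorem epsToArch_mem (hT : 1 ≤ T) {P : List HV} (hP : P ∈ epsWalks T L) :
    epsToArch L P ∈ (midWalks (stripV T (L + 1))).filter fun Q => IsAlphaDart (finalDart Q) := by
  obtain ⟨l, hl, r, m, rfl, hmap, hc, hh, hnd, hV, hmT, hadj⟩ := epsToArch_spec hT hP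
  have hne : l ++ exitTail r L m ≠ [] := by simp [hl]
  have hlast : (l ++ exitTail r L m).getLast hne = (exitX r L 0 false, 0, false) := by
    rw [← Option.some_inj, ← List.getLast?_eq_some_getLast, List.getLast?_append,
      List.getLast?_eq_some_getLast (exitTail_ne_nil r L m), getLast_exitTail]
    rfl
  rw [hmap, mem_filter, mem_midWalks_iff, isMidWalk_cons_append_iff _ hne, finalDart_cons_append hne, hlast]
  refine ⟨⟨?_, ?_, ?_, ?_, ?_, ?_⟩, ?_⟩
  · -- chain
    refine List.IsChain.append hc (isChain_exitTail r L m) fun x hx y hy => ?_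
    rw [List.getLast?_eq_some_getLast hl, Option.mem_def, Option.some_inj] at hx
    rw [head?_exitTail, Option.mem_def, Option.some_inj] at hy
    subst hx; subst hy; exact hadj
  · rw [List.head?_append_of_ne_nil _ hl, hh]
  · simp [hvGraph_adj, AdjRel, exitEnd]
  · intro x hx
    rcases List.mem_append.1 hx with hx | hx
    · exact stripV_mono_L (Nat.le_succ L) (hV x hx)
    · exact mem_stripV_succ_of_mem_exitTail hmT hx
  · refine List.Nodup.append hnd (nodup_exitTail r L m) fun x hx hx' => ?_
    exact not_mem_stripV_of_mem_exitTail hx' (hV x hx)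
  · -- no retracing: the previous vertex has row ≥ 0 (or is `w`), the end has row `−1` and abscissa `≠ 0`
    intro heq
    rcases prevOf_mem (l ++ exitTail r L m) with h | h
    · rw [← heq] at h
      have := congrArg Prod.fst h
      cases r <;> simp [exitEnd, exitX, wOut] at this <;> omega
    · rw [← heq] at h
      rcases List.mem_append.1 h with h | h
      · have := (mem_stripV_iff.1 (hV _ h)).1; simp [exitEnd] at this
      · have := (mem_exitTail h).1; simp [exitEnd] at this
  · exact ⟨rfl, rfl, rfl⟩

/-- **The surgery keeps the surface contacts** (the column stays at levels `≤ 2T − 2`). [cite: BeatonBousquetMelouDeGierDuminilCopinGuttmann2014, §2 (arXiv v5 p. 4: c(γ), "the number of contacts with the surface"; p. 8); lane] -/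
theorem surfContacts_epsToArch (hT : 1 ≤ T) {P : List HV} (hP : P ∈ epsWalks T L) :
    surfContacts T (epsToArch L P) = surfContacts T P := by
  obtain ⟨l, hl, r, m, rfl, hmap, -, -, -, -, hmT, -⟩ := epsToArch_spec hT hP
  rw [hmap, surfContacts_cons_append, surfContacts_cons_append, List.filter_append, List.length_append]
  suffices h : ((exitTail r L m).filter fun v => lev v = 2 * (T : ℤ) - 1) = [] by rw [h]; simp
  rw [List.filter_eq_nil_iff]
  intro v hv
  have := (mem_exitTail hv).2.2.1
  simp only [decide_eq_true_eq]
  omega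

/-- **The surgery adds `2m + 1 ≤ 2T − 1` vertices** (`m` = the exit row). [cite: DuminilCopinSmirnov2012, §1 (ℓ(γ)); lane] -/
theorem mwLen_epsToArch (hT : 1 ≤ T) {P : List HV} (hP : P ∈ epsWalks T L) :
    ∃ m : ℕ, m + 1 ≤ T ∧ mwLen (epsToArch L P) = mwLen P + (2 * m + 1) := by
  obtain ⟨l, hl, r, m, rfl, hmap, -, -, -, -, hmT, -⟩ := epsToArch_spec hT hP
  refine ⟨m, hmT, ?_⟩
  rw [hmap, mwLen_cons_append, mwLen_cons_append, List.length_append, length_exitTail]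

/-- **The surgery is injective on the `ε`-walks of `S_{T,L}`**: the original inner list is recovered as the part of the new one inside
`S_{T,L}`, and the exit vertex is determined by the last inner vertex. [cite: DuminilCopinSmirnov2012, §3 (ε, ε̄); lane] -/
theorem epsToArch_injOn (hT : 1 ≤ T) : Set.InjOn (epsToArch L) (epsWalks T L : Set (List HV)) := by
  classical
  intro P₁ hP₁ P₂ hP₂ heq
  obtain ⟨l₁, hl₁, r₁, m₁, rfl, hmap₁, -, -, -, hV₁, -, -⟩ := epsToArch_spec hT (mem_coe.1 hP₁)
  obtain ⟨l₂, hl₂, r₂, m₂, rfl, hmap₂, -, -, -, hV₂, -, -⟩ := epsToArch_spec hT (mem_coe.1 hP₂)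
  -- recover `l` as the sublist of vertices inside `S_{T,L}`
  have key : ∀ (l : List HV) (r : Bool) (m : ℕ), (∀ x ∈ l, x ∈ stripV T L) →
      ((l ++ exitTail r L m) ++ [exitEnd r L]).filter (fun v => decide (v ∈ stripV T L)) = l := by
    intro l r m hV
    rw [List.filter_append, List.filter_append, List.filter_eq_self.2 (by simpa using hV),
      (List.filter_eq_nil_iff).2 (fun v hv => by simpa using not_mem_stripV_of_mem_exitTail (T := T) hv),
      (List.filter_eq_nil_iff).2 (fun v hv => ?_)]
    · simp
    · rw [List.mem_singleton] at hv; subst hv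
      simp only [decide_eq_true_eq, mem_stripV_iff, exitEnd]
      omega
  rw [hmap₁, hmap₂] at heq
  have htl := List.tail_eq_of_cons_eq heq
  have hl : l₁ = l₂ := by rw [← key l₁ r₁ m₁ hV₁, ← key l₂ r₂ m₂ hV₂, htl]
  subst hl
  -- the exit vertex is determined by the last inner vertex
  have hε₁ := (mem_filter.1 (mem_coe.1 hP₁)).2
  have hε₂ := (mem_filter.1 (mem_coe.1 hP₂)).2
  rw [finalDart_cons_append hl₁] at hε₁ hε₂
  have hz0 : 0 ≤ (l₁.getLast hl₁).2.1 := (mem_stripV_iff.1 (hV₁ _ (List.getLast_mem hl₁))).1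
  rw [eps_exit_unique hz0 hε₁ hε₂]

/-! ### `x_c^{2T−1} E_{T,L}(x_c; y) ≤ A_{T,L+1}(x_c; y)` -/

/-- **`x_c^{2T−1} · E_{T,L}(x_c; y) ≤ A_{T,L+1}(x_c; y)`** for `T ≥ 1`, every `L` and every `y ≥ 0`: the surgery is an injection of
the side exits of `S_{T,L}` into the arches of `S_{T,L+1}`, keeping the contacts and costing at most `2T − 1` vertices.
[cite: BeatonBousquetMelouDeGierDuminilCopinGuttmann2014, Corollary 8 (arXiv v5 p. 12: the common radius of A_T(x_c;·), B_T(x_c;·)); lane: injective comparison E ≤ x_c^{1−2T} A, not stated in print] -/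
theorem mul_stripGFy_eps_le_alpha_succ (hT : 1 ≤ T) (L : ℕ) {y : ℝ} (hy : 0 ≤ y) :
    hexCriticalFugacity ^ (2 * T - 1) * stripGFy T L (IsEpsDart L) y ≤ stripGFy T (L + 1) IsAlphaDart y := by
  classical
  obtain ⟨hx0, hx1⟩ := hexCriticalFugacity_pos_lt_one
  have himg : (epsWalks T L).image (epsToArch L) ⊆
      (midWalks (stripV T (L + 1))).filter fun Q => IsAlphaDart (finalDart Q) := by
    intro Q hQ
    obtain ⟨P, hP, rfl⟩ := mem_image.1 hQ
    exact epsToArch_mem hT hP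
  calc hexCriticalFugacity ^ (2 * T - 1) * stripGFy T L (IsEpsDart L) y
      = ∑ P ∈ epsWalks T L, hexCriticalFugacity ^ (2 * T - 1) * (hexCriticalFugacity ^ mwLen P * y ^ surfContacts T P) := by
        rw [stripGFy_eps_eq, mul_sum]
    _ ≤ ∑ P ∈ epsWalks T L, hexCriticalFugacity ^ mwLen (epsToArch L P) * y ^ surfContacts T (epsToArch L P) := by
        refine sum_le_sum fun P hP => ?_
        obtain ⟨m, hmT, hlen⟩ := mwLen_epsToArch hT hP
        rw [surfContacts_epsToArch hT hP, hlen, ← mul_assoc, ← pow_add, add_comm (2 * T - 1)]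
        refine mul_le_mul_of_nonneg_right (pow_le_pow_of_le_one hx0.le hx1.le (by omega)) (pow_nonneg hy _)
    _ = ∑ Q ∈ (epsWalks T L).image (epsToArch L), hexCriticalFugacity ^ mwLen Q * y ^ surfContacts T Q := by
        rw [sum_image (epsToArch_injOn hT)]
    _ ≤ stripGFy T (L + 1) IsAlphaDart y :=
        sum_le_sum_of_subset_of_nonneg himg fun _ _ _ => mul_nonneg (pow_nonneg hx0.le _) (pow_nonneg hy _)

/-- The same with the constant on the other side: `E_{T,L}(x_c; y) ≤ x_c^{−(2T−1)} A_{T,L+1}(x_c; y)` (`y ≥ 0`).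
[cite: BeatonBousquetMelouDeGierDuminilCopinGuttmann2014, Corollary 8 (arXiv v5 p. 12); lane] -/
theorem stripGFy_eps_le_mul_alpha_succ (hT : 1 ≤ T) (L : ℕ) {y : ℝ} (hy : 0 ≤ y) :
    stripGFy T L (IsEpsDart L) y ≤ (hexCriticalFugacity ^ (2 * T - 1))⁻¹ * stripGFy T (L + 1) IsAlphaDart y := by
  have hx := pow_pos hexCriticalFugacity_pos_lt_one.1 (2 * T - 1)
  rw [le_inv_mul_iff₀ hx]
  exact mul_stripGFy_eps_le_alpha_succ hT L hy

/-! ### Beyond `y*`: bounded arches force bounded bridges -/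

/-- `β(y) < 0` for `y > y* = 1 + √2`. [cite: BeatonBousquetMelouDeGierDuminilCopinGuttmann2014, §4.1 eq. (16) (arXiv v5 p. 13: β(y) = (y* − y)/(y(y* − 1)))] -/
theorem betaY_neg_of_yStar_lt {y : ℝ} (hy : yStar < y) : betaY y < 0 := by
  unfold yStar at hy
  have hy0 : 0 < y := lt_trans (by positivity) hy
  unfold betaY
  exact div_neg_of_neg_of_pos (by linarith) (by positivity)

/-- **Bounded arches bound the bridges beyond `y*`**: if `A_{T,L'}(x_c; y) ≤ K` for all `L'` and `y > y*`, then for every `L`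
`(−β(y)) · B_{T,L}(x_c; y) ≤ (cos(3π/8) + cos(π/4) x_c^{−(2T−1)}) · K` — identity (16) with the side term converted into arches.
[cite: BeatonBousquetMelouDeGierDuminilCopinGuttmann2014, §4.1 eq. (16) (arXiv v5 p. 13) and Corollary 8 (p. 12); lane] -/
theorem stripGFy_beta_le_of_alpha_le (hT : 1 ≤ T) {y K : ℝ} (hy : yStar < y)
    (hA : ∀ L, stripGFy T L IsAlphaDart y ≤ K) (L : ℕ) :
    (-betaY y) * stripGFy T L (IsBetaDart T) y ≤
      (Real.cos (3 * Real.pi / 8) + Real.cos (Real.pi / 4) * (hexCriticalFugacity ^ (2 * T - 1))⁻¹) * K := by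
  have hy0 : 0 < y := yStar_pos.trans hy
  have hid := stripIdentityY_holds T L y hT hy0
  have hcα := cos_three_pi_div_eight_pos
  have hcε := cos_pi_div_four_pos'
  have hE := stripGFy_eps_le_mul_alpha_succ hT L hy0.le
  have hA0 := hA L
  have hA1 := hA (L + 1)
  have hxi : 0 ≤ (hexCriticalFugacity ^ (2 * T - 1))⁻¹ := inv_nonneg.2 (pow_nonneg hexCriticalFugacity_pos_lt_one.1.le _)
  nlinarith [mul_le_mul_of_nonneg_left hE hcε.le, mul_le_mul_of_nonneg_left hA0 hcα.le,
    mul_le_mul_of_nonneg_left (mul_le_mul_of_nonneg_left hA1 hxi) hcε.le]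

/-- **Beyond `y*`, bounded arches ⇒ bounded bridges.** [cite: BeatonBousquetMelouDeGierDuminilCopinGuttmann2014, Corollary 8 (arXiv v5 p. 12: common radius); lane: the half not in `HexSAWStripSurfaceThresholdClasses`] -/
theorem bddAbove_stripGFy_beta_of_alpha (hT : 1 ≤ T) {y : ℝ} (hy : yStar < y)
    (hA : BddAbove (Set.range fun L : ℕ => stripGFy T L IsAlphaDart y)) :
    BddAbove (Set.range fun L : ℕ => stripGFy T L (IsBetaDart T) y) := by
  obtain ⟨K, hK⟩ := hA
  have hβ := betaY_neg_of_yStar_lt hy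
  set C := (Real.cos (3 * Real.pi / 8) + Real.cos (Real.pi / 4) * (hexCriticalFugacity ^ (2 * T - 1))⁻¹) * K
  refine ⟨C / (-betaY y), ?_⟩
  rintro _ ⟨L, rfl⟩
  rw [le_div_iff₀ (by linarith), mul_comm]
  exact stripGFy_beta_le_of_alpha_le hT hy (fun L => hK ⟨L, rfl⟩) L

/-- **Away from `y*` the two classes are bounded together**: for `0 ≤ y`, `y ≠ y*`, bounded arches put `y` in the boundedness set
`stripBddSet T` of the bridges (the converse is the tree's `stripBddSet_subset_alpha`).  (At `y = y*` the conclusion also holds, by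
`y* < y_T`, which is not a tree fact used here.)
[cite: BeatonBousquetMelouDeGierDuminilCopinGuttmann2014, Corollary 8 (arXiv v5 p. 12) and §4.2 (p. 14: A_{T,L}(x_c; y*) bounded in L; whence (17) y* ≤ y_c); lane] -/
theorem mem_stripBddSet_of_bddAbove_alpha (hT : 1 ≤ T) {y : ℝ} (hy0 : 0 ≤ y) (hne : y ≠ yStar)
    (hA : BddAbove (Set.range fun L : ℕ => stripGFy T L IsAlphaDart y)) : y ∈ stripBddSet T := by
  rcases lt_or_gt_of_ne hne with hlt | hgt
  · -- below y*: bounded outright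
    rcases hy0.eq_or_lt with rfl | hpos
    · obtain ⟨-, K, hK⟩ := mem_stripBddSet_of_lt hT (half_pos yStar_pos) (half_lt_self yStar_pos)
      exact ⟨le_rfl, K, by
        rintro _ ⟨L, rfl⟩
        exact (stripGFy_mono T L _ le_rfl (half_pos yStar_pos).le).trans (hK ⟨L, rfl⟩)⟩
    · exact mem_stripBddSet_of_lt hT hpos hlt
  · exact ⟨hy0, bddAbove_stripGFy_beta_of_alpha hT hgt hA⟩

/-- The equivalence away from `y*`: `y ∈ stripBddSet T ↔ L ↦ A_{T,L}(x_c; y)` bounded (`0 ≤ y ≠ y*`, `T ≥ 1`).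
[cite: BeatonBousquetMelouDeGierDuminilCopinGuttmann2014, Corollary 8 (arXiv v5 p. 12: A_T(x_c;·) and B_T(x_c;·) have the same radius y_T); lane] -/
theorem mem_stripBddSet_iff_bddAbove_alpha (hT : 1 ≤ T) {y : ℝ} (hy0 : 0 ≤ y) (hne : y ≠ yStar) :
    y ∈ stripBddSet T ↔ BddAbove (Set.range fun L : ℕ => stripGFy T L IsAlphaDart y) :=
  ⟨fun h => (stripBddSet_subset_alpha hT h).2, mem_stripBddSet_of_bddAbove_alpha hT hy0 hne⟩

/-! ### The radius of `A_T(x_c; ·)` is at most `y_T` -/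

/-- For `y > y_T` the bridge class is unbounded (definition of `y_T` as a supremum). [cite: BeatonBousquetMelouDeGierDuminilCopinGuttmann2014, Corollary 8 (arXiv v5 p. 12)] -/
theorem not_bddAbove_stripGFy_beta_of_stripYT_lt (hT : 1 ≤ T) {y : ℝ} (h : stripYT T < y) :
    ¬ BddAbove (Set.range fun L : ℕ => stripGFy T L (IsBetaDart T) y) := fun hb =>
  absurd (le_stripYT hT ((yStar_pos.trans_le (yStar_le_stripYT hT)).trans h).le hb) (not_le.2 h)

/-- ★ **For `y > y_T` the arch class `L ↦ A_{T,L}(x_c; y)` is unbounded** (`T ≥ 1`): the radius of convergence of the arch series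
`A_T(x_c; ·)` is AT MOST `y_T` — with `HV.bddAbove_stripGFy_alpha_of_lt_stripYT` (`HexSAWStripSurfaceThresholdClasses.lean`: bounded
for `y < y_T`) it is EXACTLY `y_T`, the printed common-radius clause for `A_T`.
[cite: BeatonBousquetMelouDeGierDuminilCopinGuttmann2014, Corollary 8 (arXiv v5 p. 12: "The series (in y) A_T(x_c, y), B_T(x_c, y) and C_T(x_c, y) have radius of convergence y_T"); lane: the "≤" half for A_T, by the ε → arch surgery and (16)] -/
theorem not_bddAbove_stripGFy_alpha_of_stripYT_lt (hT : 1 ≤ T) {y : ℝ} (h : stripYT T < y) :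
    ¬ BddAbove (Set.range fun L : ℕ => stripGFy T L IsAlphaDart y) := fun hA =>
  not_bddAbove_stripGFy_beta_of_stripYT_lt hT h
    (bddAbove_stripGFy_beta_of_alpha hT ((yStar_le_stripYT hT).trans_lt h) hA)

/-- For `y > y_T`, `A_{T,L}(x_c; y) → ∞` as `L → ∞` (monotone and unbounded). [cite: BeatonBousquetMelouDeGierDuminilCopinGuttmann2014, Corollary 8 (arXiv v5 p. 12); lane] -/
theorem tendsto_stripGFy_alpha_atTop_of_stripYT_lt (hT : 1 ≤ T) {y : ℝ} (h : stripYT T < y) :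
    Tendsto (fun L : ℕ => stripGFy T L IsAlphaDart y) atTop atTop := by
  have hy0 : 0 ≤ y := ((yStar_pos.trans_le (yStar_le_stripYT hT)).trans h).le
  refine tendsto_atTop_atTop_of_monotone (fun L L' hLL' => stripGFy_alpha_mono_L hLL' hy0) fun b => ?_
  by_contra hb
  push Not at hb
  exact not_bddAbove_stripGFy_alpha_of_stripYT_lt hT h ⟨b, by rintro _ ⟨L, rfl⟩; exact (hb L).le⟩

/-- For `y > y_T`, `B_{T,L}(x_c; y) → ∞` as `L → ∞`. [cite: BeatonBousquetMelouDeGierDuminilCopinGuttmann2014, Corollary 8 (arXiv v5 p. 12)] -/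
theorem tendsto_stripGFy_beta_atTop_of_stripYT_lt (hT : 1 ≤ T) {y : ℝ} (h : stripYT T < y) :
    Tendsto (fun L : ℕ => stripGFy T L (IsBetaDart T) y) atTop atTop := by
  have hy0 : 0 ≤ y := ((yStar_pos.trans_le (yStar_le_stripYT hT)).trans h).le
  refine tendsto_atTop_atTop_of_monotone (fun L L' hLL' => stripGFy_beta_mono_L hLL' hy0) fun b => ?_
  by_contra hb
  push Not at hb
  exact not_bddAbove_stripGFy_beta_of_stripYT_lt hT h ⟨b, by rintro _ ⟨L, rfl⟩; exact (hb L).le⟩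

end Literature.Probability.RandomPlanarGeometry.SAW.HV
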